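import Summits.NavierStokesRegularity.NavierStokesRegularity.Theses.PalasekTowerBreakdown
import Summits.NavierStokesRegularity.FluidComputer.PalasekTowerGermHostMechanismDoorAt
import Summits.NavierStokesRegularity.FluidComputer.PalasekTowerMechanismDoorAtScaled

/-!
# `EpisodeBaseT` (crux stmt-NavierStokesRegularity-20303) from ONE free run of the first tuned window IN ARBITRARY
# UNITS — free start time, centre, speed normalisation and viscosity — BY NAME and with no hypothesis

Cell `ns-blowup`, seat `ns-blowup-ecbridge-3` (g12; D-0074 GROUP C «BRIDGE SUPPORT», lineage `host_preparation`).
Route `PalasekTowerBreakdown` (rev 19): `EpisodeBaseT := EpisodeBaseGAt TowerRates.tuned`; line `straindoor`, whose stub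
`StrainDoor.MechanismDoorAt TowerRates.tuned` is the tree theorem `palasekTowerBreakdown_mechanismDoorAt_tuned` (p540639).
LABEL: E–C typing (KERNEL: theorems only; `--supports` stmt-NavierStokesRegularity-20303). WHAT THIS IS NOT: not
Navier–Stokes evidence — no run of the first tuned window is exhibited; `EpisodeBaseT` appears only as the conclusion
of a conditional; nothing about `RungG 1` or blow-up is asserted.

`palasekTowerBreakdown_episodeBaseT_of_scaled_freeRun` = the door at `tuned` (`Germ.mechanismDoorAt_of_boxNumerics
TowerRates.tuned_boxNumerics`, the proof term of p540639) composed with the units dictionary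
`StrainDoor.MechanismDoorAt.episodeBaseGAt_of_scaledFreeRun` (`FluidComputer/PalasekTowerMechanismDoorAtScaled`): a
classical FREE Navier–Stokes run with ANY viscosity `ν' > 0` on ANY window `[t_a, t_a + κ²ν'·wfirstAt tuned]` from a
compactly supported slice `v t_a` (ANY centre `x₀`) with `κ ‖v t_a‖ < Y₀(tuned)` everywhere (ANY speed conversion
`κ > 0`), under the cap `κ ‖v‖ ≤ (5/3)Y₁(tuned) − η`, showing at the end of the window, inside the support ball, speed
`κ ‖v‖ ≥ Y₁(tuned) + η`, gradient `κ²ν' ‖Dv‖ ≥ A₁(tuned) + η` and a `C¹` loop in a ball of radius `κν'/N₁(tuned)` with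
speed `≤ 8πκν'/N₁(tuned)` and circulation `≥ ν'(N₁(tuned)^{β−2} + η)` ⟹ `EpisodeBaseT`. In the cell's kit normalisation
(`Y₀ = A₀ = 1`, `ν' = N₀^{2−β} ≈ 1/776`; datum speed `< m`, `κ = Y₀(tuned)/m`): window `169.85/m²` after ANY start time,
thresholds `2.0705 m`, `3.482 m²`, `1.231` inside radius `0.5946/m`, cap `3.45 m` (seat evidence #43 on 20303,
`DOOR-REREAD-T0.md`). The start of the window is the designer's release time — the host, the anchor and the crossing of
`Y₀` are supplied by the force inside the door — so a kit series may be read from ANY record `t_a` with `m = M(t_a)`.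

References: J. Leray, Acta Math. 63 (1934) §20 [cite: Leray1934, §20]; S. Palasek, arXiv:2605.13827 §4
[cite: Palasek2026ElementaryModel, §4]; T. Tao, Anal. PDE 6 (2013) Thm. 5.4 [cite: Tao2011, Thm. 5.4 (ii)+(iv)].
-/

noncomputable section

-- `Summit.<Summit>.<Problem>` is the tree's mandated summit-side namespace (CONVENTIONS §2); for this
-- single-conjunct summit the two coincide, so the duplicate is deliberate.
set_option linter.dupNamespace false

namespace Summit.NavierStokesRegularity.NavierStokesRegularity.Theorems

open Set Function MeasureTheory Metric
open scoped ENNReal ContDiff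
open Summit.NavierStokesRegularity.NavierStokesRegularity.Theses
open Summit.NavierStokesRegularity.FluidComputer.PalasekTowerClayBridge
open Literature.Analysis.FluidPDE

/-- **`EpisodeBaseT` FROM ONE FREE RUN OF THE FIRST TUNED WINDOW IN ARBITRARY UNITS** (no hypothesis beyond the run):
viscosity `ν' > 0`, speed conversion `κ > 0`, start time `t_a`, centre `x₀` free; window length
`T = κ²ν' · wfirstAt tuned`; datum slice compactly supported in `B̄(x₀, ρ)` with `κ‖v t_a x‖ < Y₀(tuned)`; finite energy;
cap `κ‖v‖ ≤ (5/3)Y₁(tuned) − η` (`η > 0`); at `t_a + T` inside `B̄(x₀, ρ)`: `Y₁(tuned) + η ≤ κ‖v‖`,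
`A₁(tuned) + η ≤ κ²ν'‖Dv‖`, and a `C¹` closed loop inside a ball of radius `κν'/N₁(tuned)` of speed `≤ 8πκν'/N₁(tuned)`
with `ν'(N₁(tuned)^{β−2} + η) ≤ ∮ v`. [cite: Palasek2026ElementaryModel, §4] [cite: Leray1934, §20] -/
theorem palasekTowerBreakdown_episodeBaseT_of_scaled_freeRun
    {ν' κ : ℝ} (hν' : 0 < ν') (hκ : 0 < κ) (t_a : ℝ) (x₀ : EuclideanSpace ℝ (Fin 3)) {T : ℝ}
    (hT : T = κ ^ 2 * ν' * Host.wfirstAt TowerRates.tuned)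
    {v : ℝ → EuclideanSpace ℝ (Fin 3) → EuclideanSpace ℝ (Fin 3)} {q : ℝ → EuclideanSpace ℝ (Fin 3) → ℝ}
    (hv : IsClassicalNSSolutionOn (Icc t_a (t_a + T)) ν' 0 v q)
    {ρ : ℝ} (hρ : 0 ≤ ρ) (hsupp : tsupport (v t_a) ⊆ closedBall x₀ ρ)
    (hlt : ∀ x, κ * ‖v t_a x‖ < TowerRates.tuned.Y 0)
    (hE : ∃ C : ℝ≥0∞, C < ⊤ ∧ ∀ t ∈ Icc t_a (t_a + T), ∫⁻ x, ‖v t x‖ₑ ^ 2 ≤ C)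
    {η : ℝ} (hη : 0 < η)
    (hcap : ∀ t ∈ Icc t_a (t_a + T), ∀ x, κ * ‖v t x‖ ≤ 5 / 3 * TowerRates.tuned.Y 1 - η)
    (hspeed : ∃ x, ‖x - x₀‖ ≤ ρ ∧ TowerRates.tuned.Y 1 + η ≤ κ * ‖v (t_a + T) x‖)
    (hstrain : ∃ x, ‖x - x₀‖ ≤ ρ ∧ TowerRates.tuned.A 1 + η ≤ κ ^ 2 * ν' * ‖fderiv ℝ (v (t_a + T)) x‖)
    (hcore : ∃ (x : EuclideanSpace ℝ (Fin 3)) (c : ℝ → EuclideanSpace ℝ (Fin 3)),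
      ‖x - x₀‖ ≤ ρ ∧ ContDiff ℝ 1 c ∧ c 0 = c 1 ∧
      (∀ s ∈ Icc (0 : ℝ) 1, c s ∈ closedBall x (κ * ν' / TowerRates.tuned.N 1)) ∧
      (∀ s ∈ Icc (0 : ℝ) 1, ‖deriv c s‖ ≤ 8 * Real.pi * (κ * ν') / TowerRates.tuned.N 1) ∧
      ν' * (TowerRates.tuned.N 1 ^ (TowerRates.tuned.β - 2) + η) ≤ circulation (v (t_a + T)) c) :
    PalasekTowerBreakdown.EpisodeBaseT := by
  unfold PalasekTowerBreakdown.EpisodeBaseT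
  exact (Germ.mechanismDoorAt_of_boxNumerics TowerRates.tuned_boxNumerics).episodeBaseGAt_of_scaledFreeRun hν' hκ t_a
    x₀ hT hv hρ hsupp hlt hE hη hcap hspeed hstrain hcore

/-- **The same door at ANY register-admissible rates** (`R.BoxNumerics c₃ q`, e.g. `wide` or `tuned`): the mechanism
door `Germ.mechanismDoorAt_of_boxNumerics` in arbitrary units ⟹ `EpisodeBaseGAt R`. [cite: Palasek2026ElementaryModel, §4] -/
theorem palasekTowerBreakdown_episodeBaseGAt_of_scaled_freeRun {R : TowerRates} {c₃ q₀ : ℝ}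
    (hR : R.BoxNumerics c₃ q₀)
    {ν' κ : ℝ} (hν' : 0 < ν') (hκ : 0 < κ) (t_a : ℝ) (x₀ : EuclideanSpace ℝ (Fin 3)) {T : ℝ}
    (hT : T = κ ^ 2 * ν' * Host.wfirstAt R)
    {v : ℝ → EuclideanSpace ℝ (Fin 3) → EuclideanSpace ℝ (Fin 3)} {q : ℝ → EuclideanSpace ℝ (Fin 3) → ℝ}
    (hv : IsClassicalNSSolutionOn (Icc t_a (t_a + T)) ν' 0 v q)
    {ρ : ℝ} (hρ : 0 ≤ ρ) (hsupp : tsupport (v t_a) ⊆ closedBall x₀ ρ)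
    (hlt : ∀ x, κ * ‖v t_a x‖ < R.Y 0)
    (hE : ∃ C : ℝ≥0∞, C < ⊤ ∧ ∀ t ∈ Icc t_a (t_a + T), ∫⁻ x, ‖v t x‖ₑ ^ 2 ≤ C)
    {η : ℝ} (hη : 0 < η)
    (hcap : ∀ t ∈ Icc t_a (t_a + T), ∀ x, κ * ‖v t x‖ ≤ 5 / 3 * R.Y 1 - η)
    (hspeed : ∃ x, ‖x - x₀‖ ≤ ρ ∧ R.Y 1 + η ≤ κ * ‖v (t_a + T) x‖)
    (hstrain : ∃ x, ‖x - x₀‖ ≤ ρ ∧ R.A 1 + η ≤ κ ^ 2 * ν' * ‖fderiv ℝ (v (t_a + T)) x‖)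
    (hcore : ∃ (x : EuclideanSpace ℝ (Fin 3)) (c : ℝ → EuclideanSpace ℝ (Fin 3)),
      ‖x - x₀‖ ≤ ρ ∧ ContDiff ℝ 1 c ∧ c 0 = c 1 ∧
      (∀ s ∈ Icc (0 : ℝ) 1, c s ∈ closedBall x (κ * ν' / R.N 1)) ∧
      (∀ s ∈ Icc (0 : ℝ) 1, ‖deriv c s‖ ≤ 8 * Real.pi * (κ * ν') / R.N 1) ∧
      ν' * (R.N 1 ^ (R.β - 2) + η) ≤ circulation (v (t_a + T)) c) :
    EpisodeBaseGAt R :=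
  (Germ.mechanismDoorAt_of_boxNumerics hR).episodeBaseGAt_of_scaledFreeRun hν' hκ t_a x₀ hT hv hρ hsupp hlt hE hη
    hcap hspeed hstrain hcore

end Summit.NavierStokesRegularity.NavierStokesRegularity.Theorems

end
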